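import Summits.Ventures.PercRepro2.CaseOneMarkLeaf

/-!
# The marks `b` and `o` pendant at a root: every statement vertex is closed
(blind cell PercRepro2, p1 g27; the three companions of `CaseOneMarkLeaf`)

Two facts about a leaf `z` at `y`: a connection from `u ≠ z` to `z` passes through `y`, so under
`{y ↮ u}` the event `{u ↔ z}` is empty (`connEvent_leaf_inter_compl_eq_empty`); and `{y ↔ z}` is the
event «the leaf edge is open», independent of every event that ignores the leaf edge
(`prob_connEvent_leaf_inter`). Hence: `b` a leaf at `a₁` — `{b ∈ C₂}` is empty under `Q` and `{b ∈ C₁}`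
factors, both `(ii-t)` and `(i-t)` are identically `0`; `b` a leaf at `a₂` — symmetric; `o` a leaf at
`a₂` — `{o ∈ C₁}` is empty under `Q`, `{o ∈ C₂}` factors, `D_o = π D` and `P(Q, o ∈ U) = π P(Q)`, and the
forms are `(c₁ π − c₀) · (BHK bracket) = 0` at both pairs. With `closedAt_of_o_leaf_root` of
`CaseOneMarkLeaf` this is **a mark pendant at a root is closed for every statement vertex**
(`closedAt_of_b_leaf_root₁`, `closedAt_of_b_leaf_root₂`, `closedAt_of_o_leaf_root₂`), and with the
pocket reduction: a mark alone in a mark-free-otherwise pocket at a root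
(`closedAt_of_b_pocket_root₁`, `closedAt_of_b_pocket_root₂`, `closedAt_of_o_pocket_root₂`). Own code;
standard axioms. -/

namespace Summit.Ventures.PercRepro2

namespace CaseOne

section LeafFacts
variable {V : Type*} {E : Type*} [Fintype E] [DecidableEq E] {R : Type*} [CommRing R]
variable {ends : E → Sym2 V} {y z : V} {e₀ : E}

omit [Fintype E] [DecidableEq E] in
/-- **A connection to a leaf passes through its neighbour**: under `{y ↮ u}` the event `{u ↔ z}` is
empty (`u ≠ z`). -/
lemma connEvent_leaf_inter_compl_eq_empty (hl : IsLeafAt ends y z e₀) {u : V} (hu : u ≠ z) :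
    connEvent ends u z ∩ (connEvent ends y u)ᶜ = ∅ := by
  ext ω
  simp only [Set.mem_inter_iff, mem_connEvent, Set.mem_compl_iff, Set.mem_empty_iff_false,
    iff_false, not_and, not_not]
  intro h
  exact conn_symm (conn_a1_of_conn_leaf hl ω hu h)

omit [Fintype E] in
/-- Membership in a connection event among vertices other than the leaf ignores the leaf edge. -/
lemma mem_connEvent_update_of_leaf (hl : IsLeafAt ends y z e₀) (ω : Config E) (c : Bool) {u v : V}
    (hu : u ≠ z) (hv : v ≠ z) :
    Function.update ω e₀ c ∈ connEvent ends u v ↔ ω ∈ connEvent ends u v := by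
  simp only [mem_connEvent]
  rw [conn_iff_update_of_leaf hl (Function.update ω e₀ c) hu hv, Function.update_idem,
    conn_iff_update_of_leaf hl ω hu hv]

/-- **The leaf edge is independent of every event that ignores it**:
`P({y ↔ z} ∩ X) = p e₀ · P(X)`. -/
lemma prob_connEvent_leaf_inter (p : E → R) (hl : IsLeafAt ends y z e₀) {X : Set (Config E)}
    (hX : ∀ ω c, Function.update ω e₀ c ∈ X ↔ ω ∈ X) :
    prob p (connEvent ends y z ∩ X) = p e₀ * prob p X := by
  rw [connEvent_leaf_eq_openEdge hl, Set.inter_comm, prob_inter_openEdge]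
  congr 1
  refine prob_update_of_ignore p e₀ 1 X fun ω c => ?_
  by_cases h : ω ∈ X
  · rw [Set.indicator_of_mem ((hX ω c).2 h), Set.indicator_of_mem h]
    rfl
  · rw [Set.indicator_of_notMem (fun h' => h ((hX ω c).1 h')), Set.indicator_of_notMem h]

end LeafFacts

/-! ## `b` a leaf at `a₁` -/

section BLeaf1
variable {V : Type*} {E : Type*} [Fintype E] [DecidableEq E] {R : Type*} [CommRing R]
  [LinearOrder R]
variable {ends : E → Sym2 V} {o a₁ a₂ a₃ b : V} {e₀ : E}

omit [LinearOrder R] in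
/-- For `b` a leaf at `a₁` (`b ≠ a₂`), every event inside `{b ∈ C₂} ∩ Q` has probability zero. -/
lemma prob_eq_zero_of_subset_b_leaf₁ (p : E → R) (hl : IsLeafAt ends a₁ b e₀) (h2 : b ≠ a₂)
    {X : Set (Config E)} (hX : X ⊆ connEvent ends a₂ b ∩ (connEvent ends a₁ a₂)ᶜ) :
    prob p X = 0 := by
  rw [connEvent_leaf_inter_compl_eq_empty hl h2.symm, Set.subset_empty_iff] at hX
  rw [hX, prob_empty]

omit [LinearOrder R] in
/-- `(ii-t)` vanishes for `b` a leaf at `a₁`. -/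
theorem iiExprT_eq_zero_of_b_leaf₁ (p : E → R) (hl : IsLeafAt ends a₁ b e₀) (h2 : b ≠ a₂)
    (c₀ c₁ : R) : iiExprT p ends o a₁ a₂ a₃ b c₀ c₁ = 0 := by
  rw [iiExprT_eq]
  rw [prob_eq_zero_of_subset_b_leaf₁ p hl h2 (X := connEvent ends a₂ b ∩ connEvent ends a₁ a₃ ∩
      connEvent ends a₂ o ∩ (connEvent ends a₁ a₂)ᶜ) (fun _ h => ⟨h.1.1.1, h.2⟩),
    prob_eq_zero_of_subset_b_leaf₁ p hl h2 (X := connEvent ends a₂ b ∩ (connEvent ends a₁ a₂)ᶜ)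
      (fun _ h => h),
    prob_eq_zero_of_subset_b_leaf₁ p hl h2 (X := connEvent ends a₂ b ∩ connEvent ends a₁ a₃ ∩
      (connEvent ends a₁ a₂)ᶜ) (fun _ h => ⟨h.1.1, h.2⟩)]
  ring

omit [LinearOrder R] in
/-- `(i-t)` vanishes for `b` a leaf at `a₁` (`o, a₂, a₃ ≠ b`): `{b ∈ C₁}` is the leaf edge. -/
theorem iExprT_eq_zero_of_b_leaf₁ (p : E → R) (hl : IsLeafAt ends a₁ b e₀) (ho : o ≠ b)
    (h2 : a₂ ≠ b) (h3 : a₃ ≠ b) (c₀ c₁ : R) : iExprT p ends o a₁ a₂ a₃ b c₀ c₁ = 0 := by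
  have h1 : a₁ ≠ b := hl.ne
  rw [iExprT_eq]
  have e1 : connEvent ends a₁ b ∩ connEvent ends a₁ a₃ ∩ connEvent ends a₂ o ∩
      (connEvent ends a₁ a₂)ᶜ = connEvent ends a₁ b ∩ (connEvent ends a₁ a₃ ∩ connEvent ends a₂ o ∩
      (connEvent ends a₁ a₂)ᶜ) := by
    simp only [Set.inter_assoc]
  have e2 : connEvent ends a₁ b ∩ connEvent ends a₁ a₃ ∩ (connEvent ends a₁ a₂)ᶜ =
      connEvent ends a₁ b ∩ (connEvent ends a₁ a₃ ∩ (connEvent ends a₁ a₂)ᶜ) := by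
    simp only [Set.inter_assoc]
  rw [e1, e2, prob_connEvent_leaf_inter p hl, prob_connEvent_leaf_inter p hl,
    prob_connEvent_leaf_inter p hl]
  · ring
  · intro ω c
    simp only [Set.mem_inter_iff, Set.mem_compl_iff]
    rw [mem_connEvent_update_of_leaf hl ω c h1 h3, mem_connEvent_update_of_leaf hl ω c h1 h2]
  · intro ω c
    simp only [Set.mem_compl_iff]
    rw [mem_connEvent_update_of_leaf hl ω c h1 h2]
  · intro ω c
    simp only [Set.mem_inter_iff, Set.mem_compl_iff]
    rw [mem_connEvent_update_of_leaf hl ω c h1 h3, mem_connEvent_update_of_leaf hl ω c h2 ho,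
      mem_connEvent_update_of_leaf hl ω c h1 h2]

/-- **`b` a leaf at the root `a₁`: every statement vertex is closed** (`o, a₂, a₃ ≠ b`). -/
theorem closedAt_of_b_leaf_root₁ (hl : IsLeafAt ends a₁ b e₀) (ho : o ≠ b) (h2 : a₂ ≠ b)
    (h3 : a₃ ≠ b) : ClosedAt R o a₁ a₂ b E ends a₃ := by
  intro p _
  refine ⟨?_, ?_, ?_, ?_⟩
  · unfold ZSplitII
    rw [iiExpr_eq_iiExprT, iiExprT_eq_zero_of_b_leaf₁ p hl h2.symm]
  · unfold ZSplitIIQ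
    rw [iiExprT_eq_zero_of_b_leaf₁ p hl h2.symm]
  · unfold ZSplitI
    rw [iExpr_eq_iExprT, iExprT_eq_zero_of_b_leaf₁ p hl ho h2 h3]
  · unfold ZSplitIQ
    rw [iExprT_eq_zero_of_b_leaf₁ p hl ho h2 h3]

end BLeaf1

/-! ## `b` a leaf at `a₂` -/

section BLeaf2
variable {V : Type*} {E : Type*} [Fintype E] [DecidableEq E] {R : Type*} [CommRing R]
  [LinearOrder R]
variable {ends : E → Sym2 V} {o a₁ a₂ a₃ b : V} {e₀ : E}

omit [LinearOrder R] in
/-- For `b` a leaf at `a₂` (`b ≠ a₁`), every event inside `{b ∈ C₁} ∩ Q` has probability zero. -/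
lemma prob_eq_zero_of_subset_b_leaf₂ (p : E → R) (hl : IsLeafAt ends a₂ b e₀) (h1 : b ≠ a₁)
    {X : Set (Config E)} (hX : X ⊆ connEvent ends a₁ b ∩ (connEvent ends a₁ a₂)ᶜ) :
    prob p X = 0 := by
  rw [connEvent_comm ends a₁ a₂, connEvent_leaf_inter_compl_eq_empty hl h1.symm,
    Set.subset_empty_iff] at hX
  rw [hX, prob_empty]

omit [LinearOrder R] in
/-- `(i-t)` vanishes for `b` a leaf at `a₂`. -/
theorem iExprT_eq_zero_of_b_leaf₂ (p : E → R) (hl : IsLeafAt ends a₂ b e₀) (h1 : b ≠ a₁)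
    (c₀ c₁ : R) : iExprT p ends o a₁ a₂ a₃ b c₀ c₁ = 0 := by
  rw [iExprT_eq]
  rw [prob_eq_zero_of_subset_b_leaf₂ p hl h1 (X := connEvent ends a₁ b ∩ connEvent ends a₁ a₃ ∩
      connEvent ends a₂ o ∩ (connEvent ends a₁ a₂)ᶜ) (fun _ h => ⟨h.1.1.1, h.2⟩),
    prob_eq_zero_of_subset_b_leaf₂ p hl h1 (X := connEvent ends a₁ b ∩ (connEvent ends a₁ a₂)ᶜ)
      (fun _ h => h),
    prob_eq_zero_of_subset_b_leaf₂ p hl h1 (X := connEvent ends a₁ b ∩ connEvent ends a₁ a₃ ∩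
      (connEvent ends a₁ a₂)ᶜ) (fun _ h => ⟨h.1.1, h.2⟩)]
  ring

omit [LinearOrder R] in
/-- `(ii-t)` vanishes for `b` a leaf at `a₂` (`o, a₁, a₃ ≠ b`): `{b ∈ C₂}` is the leaf edge. -/
theorem iiExprT_eq_zero_of_b_leaf₂ (p : E → R) (hl : IsLeafAt ends a₂ b e₀) (ho : o ≠ b)
    (h1 : a₁ ≠ b) (h3 : a₃ ≠ b) (c₀ c₁ : R) : iiExprT p ends o a₁ a₂ a₃ b c₀ c₁ = 0 := by
  have h2 : a₂ ≠ b := hl.ne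
  rw [iiExprT_eq]
  have e1 : connEvent ends a₂ b ∩ connEvent ends a₁ a₃ ∩ connEvent ends a₂ o ∩
      (connEvent ends a₁ a₂)ᶜ = connEvent ends a₂ b ∩ (connEvent ends a₁ a₃ ∩ connEvent ends a₂ o ∩
      (connEvent ends a₁ a₂)ᶜ) := by
    simp only [Set.inter_assoc]
  have e2 : connEvent ends a₂ b ∩ connEvent ends a₁ a₃ ∩ (connEvent ends a₁ a₂)ᶜ =
      connEvent ends a₂ b ∩ (connEvent ends a₁ a₃ ∩ (connEvent ends a₁ a₂)ᶜ) := by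
    simp only [Set.inter_assoc]
  rw [e1, e2, prob_connEvent_leaf_inter p hl, prob_connEvent_leaf_inter p hl,
    prob_connEvent_leaf_inter p hl]
  · ring
  · intro ω c
    simp only [Set.mem_inter_iff, Set.mem_compl_iff]
    rw [mem_connEvent_update_of_leaf hl ω c h1 h3, mem_connEvent_update_of_leaf hl ω c h1 h2]
  · intro ω c
    simp only [Set.mem_compl_iff]
    rw [mem_connEvent_update_of_leaf hl ω c h1 h2]
  · intro ω c
    simp only [Set.mem_inter_iff, Set.mem_compl_iff]
    rw [mem_connEvent_update_of_leaf hl ω c h1 h3, mem_connEvent_update_of_leaf hl ω c h2 ho,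
      mem_connEvent_update_of_leaf hl ω c h1 h2]

/-- **`b` a leaf at the root `a₂`: every statement vertex is closed** (`o, a₁, a₃ ≠ b`). -/
theorem closedAt_of_b_leaf_root₂ (hl : IsLeafAt ends a₂ b e₀) (ho : o ≠ b) (h1 : a₁ ≠ b)
    (h3 : a₃ ≠ b) : ClosedAt R o a₁ a₂ b E ends a₃ := by
  intro p _
  refine ⟨?_, ?_, ?_, ?_⟩
  · unfold ZSplitII
    rw [iiExpr_eq_iiExprT, iiExprT_eq_zero_of_b_leaf₂ p hl ho h1 h3]
  · unfold ZSplitIIQ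
    rw [iiExprT_eq_zero_of_b_leaf₂ p hl ho h1 h3]
  · unfold ZSplitI
    rw [iExpr_eq_iExprT, iExprT_eq_zero_of_b_leaf₂ p hl h1.symm]
  · unfold ZSplitIQ
    rw [iExprT_eq_zero_of_b_leaf₂ p hl h1.symm]

end BLeaf2

/-! ## `o` a leaf at `a₂` -/

section OLeaf2
variable {V : Type*} {E : Type*} [Fintype E] [DecidableEq E] {R : Type*} [CommRing R]
  [LinearOrder R]
variable {ends : E → Sym2 V} {o a₁ a₂ a₃ b : V} {e₀ : E}

omit [Fintype E] [DecidableEq E] [LinearOrder R] in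
/-- For `o` a leaf at `a₂` (`o ≠ a₁`), under `Q` the event `{o ∈ U}` is `{o ∈ C₂}`. -/
lemma union_inter_Q_eq_of_o_leaf₂ (hl : IsLeafAt ends a₂ o e₀) (h1 : o ≠ a₁) (Y : Set (Config E)) :
    (connEvent ends a₁ o ∪ connEvent ends a₂ o) ∩ Y ∩ (connEvent ends a₁ a₂)ᶜ =
      connEvent ends a₂ o ∩ (Y ∩ (connEvent ends a₁ a₂)ᶜ) := by
  ext ω
  simp only [Set.mem_inter_iff, Set.mem_union, mem_connEvent, Set.mem_compl_iff]
  constructor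
  · rintro ⟨⟨h | h, hY⟩, hQ⟩
    · exact absurd (conn_a1_of_conn_leaf hl ω h1.symm h) hQ
    · exact ⟨h, hY, hQ⟩
  · rintro ⟨h, hY, hQ⟩
    exact ⟨⟨Or.inr h, hY⟩, hQ⟩

omit [LinearOrder R] in
/-- `D_o = π · D` for `o` a leaf at `a₂` (`a₁, a₃ ≠ o`). -/
lemma Dpdo_eq_of_o_leaf₂ (p : E → R) (hl : IsLeafAt ends a₂ o e₀) (h1 : a₁ ≠ o) (h3 : a₃ ≠ o) :
    Dpdo p ends o a₁ a₂ a₃ = p e₀ * Dpd p ends a₁ a₂ a₃ := by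
  have h2 : a₂ ≠ o := hl.ne
  unfold Dpdo Dpd
  rw [Set.inter_assoc (connEvent ends a₁ o ∪ connEvent ends a₂ o),
    union_inter_Q_eq_of_o_leaf₂ hl h1.symm, prob_connEvent_leaf_inter p hl]
  intro ω c
  simp only [Set.mem_inter_iff, Set.mem_compl_iff]
  rw [mem_connEvent_update_of_leaf hl ω c h1 h3, mem_connEvent_update_of_leaf hl ω c h2 h3,
    mem_connEvent_update_of_leaf hl ω c h1 h2]

omit [LinearOrder R] in
/-- `P(Q, o ∈ U) = π · P(Q)` for `o` a leaf at `a₂` (`a₁ ≠ o`). -/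
lemma Dqo_eq_of_o_leaf₂ (p : E → R) (hl : IsLeafAt ends a₂ o e₀) (h1 : a₁ ≠ o) :
    Dqo p ends o a₁ a₂ = p e₀ * prob p (connEvent ends a₁ a₂)ᶜ := by
  have h2 : a₂ ≠ o := hl.ne
  unfold Dqo
  have := union_inter_Q_eq_of_o_leaf₂ hl h1.symm (Set.univ : Set (Config E))
  simp only [Set.inter_univ, Set.univ_inter] at this
  rw [this, prob_connEvent_leaf_inter p hl]
  intro ω c
  simp only [Set.mem_compl_iff]
  rw [mem_connEvent_update_of_leaf hl ω c h1 h2]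

omit [LinearOrder R] in
/-- `(ii-t)` for `o` a leaf at `a₂` is `(c₁ π − c₀)` times the BHK bracket. -/
lemma iiExprT_eq_of_o_leaf₂ (p : E → R) (hl : IsLeafAt ends a₂ o e₀) (h1 : a₁ ≠ o) (h3 : a₃ ≠ o)
    (hb : b ≠ o) (c₀ c₁ : R) :
    iiExprT p ends o a₁ a₂ a₃ b c₀ c₁ = (c₁ * p e₀ - c₀) *
      (prob p (connEvent ends a₁ a₂)ᶜ *
        prob p (connEvent ends a₂ b ∩ connEvent ends a₁ a₃ ∩ (connEvent ends a₁ a₂)ᶜ) -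
      prob p (connEvent ends a₂ b ∩ (connEvent ends a₁ a₂)ᶜ) *
        prob p (connEvent ends a₁ a₃ ∩ (connEvent ends a₁ a₂)ᶜ)) := by
  have h2 : a₂ ≠ o := hl.ne
  rw [iiExprT_eq]
  have e1 : connEvent ends a₂ b ∩ connEvent ends a₁ a₃ ∩ connEvent ends a₂ o ∩
      (connEvent ends a₁ a₂)ᶜ = connEvent ends a₂ o ∩ (connEvent ends a₂ b ∩ connEvent ends a₁ a₃ ∩
      (connEvent ends a₁ a₂)ᶜ) := by
    ext ω
    simp only [Set.mem_inter_iff]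
    tauto
  have e2 : connEvent ends a₁ a₃ ∩ connEvent ends a₂ o ∩ (connEvent ends a₁ a₂)ᶜ =
      connEvent ends a₂ o ∩ (connEvent ends a₁ a₃ ∩ (connEvent ends a₁ a₂)ᶜ) := by
    ext ω
    simp only [Set.mem_inter_iff]
    tauto
  rw [e1, e2, prob_connEvent_leaf_inter p hl, prob_connEvent_leaf_inter p hl]
  · ring
  · intro ω c
    simp only [Set.mem_inter_iff, Set.mem_compl_iff]
    rw [mem_connEvent_update_of_leaf hl ω c h1 h3, mem_connEvent_update_of_leaf hl ω c h1 h2]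
  · intro ω c
    simp only [Set.mem_inter_iff, Set.mem_compl_iff]
    rw [mem_connEvent_update_of_leaf hl ω c h2 hb, mem_connEvent_update_of_leaf hl ω c h1 h3,
      mem_connEvent_update_of_leaf hl ω c h1 h2]

omit [LinearOrder R] in
/-- `(i-t)` for `o` a leaf at `a₂` is `(c₁ π − c₀)` times the BHK bracket. -/
lemma iExprT_eq_of_o_leaf₂ (p : E → R) (hl : IsLeafAt ends a₂ o e₀) (h1 : a₁ ≠ o) (h3 : a₃ ≠ o)
    (hb : b ≠ o) (c₀ c₁ : R) :
    iExprT p ends o a₁ a₂ a₃ b c₀ c₁ = -(c₁ * p e₀ - c₀) *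
      (prob p (connEvent ends a₁ a₂)ᶜ *
        prob p (connEvent ends a₁ b ∩ connEvent ends a₁ a₃ ∩ (connEvent ends a₁ a₂)ᶜ) -
      prob p (connEvent ends a₁ b ∩ (connEvent ends a₁ a₂)ᶜ) *
        prob p (connEvent ends a₁ a₃ ∩ (connEvent ends a₁ a₂)ᶜ)) := by
  have h2 : a₂ ≠ o := hl.ne
  rw [iExprT_eq]
  have e1 : connEvent ends a₁ b ∩ connEvent ends a₁ a₃ ∩ connEvent ends a₂ o ∩
      (connEvent ends a₁ a₂)ᶜ = connEvent ends a₂ o ∩ (connEvent ends a₁ b ∩ connEvent ends a₁ a₃ ∩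
      (connEvent ends a₁ a₂)ᶜ) := by
    ext ω
    simp only [Set.mem_inter_iff]
    tauto
  have e2 : connEvent ends a₁ a₃ ∩ connEvent ends a₂ o ∩ (connEvent ends a₁ a₂)ᶜ =
      connEvent ends a₂ o ∩ (connEvent ends a₁ a₃ ∩ (connEvent ends a₁ a₂)ᶜ) := by
    ext ω
    simp only [Set.mem_inter_iff]
    tauto
  rw [e1, e2, prob_connEvent_leaf_inter p hl, prob_connEvent_leaf_inter p hl]
  · ring
  · intro ω c
    simp only [Set.mem_inter_iff, Set.mem_compl_iff]
    rw [mem_connEvent_update_of_leaf hl ω c h1 h3, mem_connEvent_update_of_leaf hl ω c h1 h2]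
  · intro ω c
    simp only [Set.mem_inter_iff, Set.mem_compl_iff]
    rw [mem_connEvent_update_of_leaf hl ω c h1 hb, mem_connEvent_update_of_leaf hl ω c h1 h3,
      mem_connEvent_update_of_leaf hl ω c h1 h2]

/-- **`o` a leaf at the root `a₂`: every statement vertex is closed** (`a₁, a₃, b ≠ o`): the four
forms vanish at both threshold pairs. -/
theorem closedAt_of_o_leaf_root₂ (hl : IsLeafAt ends a₂ o e₀) (h1 : a₁ ≠ o) (h3 : a₃ ≠ o)
    (hb : b ≠ o) : ClosedAt R o a₁ a₂ b E ends a₃ := by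
  intro p _
  refine ⟨?_, ?_, ?_, ?_⟩
  · unfold ZSplitII
    rw [iiExpr_eq_iiExprT, iiExprT_eq_of_o_leaf₂ p hl h1 h3 hb, Dpdo_eq_of_o_leaf₂ p hl h1 h3]
    rw [show Dpd p ends a₁ a₂ a₃ * p e₀ - p e₀ * Dpd p ends a₁ a₂ a₃ = 0 by ring, zero_mul]
  · unfold ZSplitIIQ
    rw [iiExprT_eq_of_o_leaf₂ p hl h1 h3 hb, Dqo_eq_of_o_leaf₂ p hl h1]
    rw [show prob p (connEvent ends a₁ a₂)ᶜ * p e₀ - p e₀ * prob p (connEvent ends a₁ a₂)ᶜ = 0 by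
      ring, zero_mul]
  · unfold ZSplitI
    rw [iExpr_eq_iExprT, iExprT_eq_of_o_leaf₂ p hl h1 h3 hb, Dpdo_eq_of_o_leaf₂ p hl h1 h3]
    rw [show -(Dpd p ends a₁ a₂ a₃ * p e₀ - p e₀ * Dpd p ends a₁ a₂ a₃) = 0 by ring, zero_mul]
  · unfold ZSplitIQ
    rw [iExprT_eq_of_o_leaf₂ p hl h1 h3 hb, Dqo_eq_of_o_leaf₂ p hl h1]
    rw [show -(prob p (connEvent ends a₁ a₂)ᶜ * p e₀ - p e₀ * prob p (connEvent ends a₁ a₂)ᶜ) = 0 by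
      ring, zero_mul]

end OLeaf2

/-! ## The pockets -/

section BPocket
variable {V : Type*} {E : Type*} [Fintype E] [DecidableEq E] {R : Type*} [CommRing R]
  [LinearOrder R] [IsStrictOrderedRing R]
variable {ends : E → Sym2 V} {W : Set V} {P : Finset E} {e₀ : E} {o a₁ a₂ a₃ b : V}

/-- **The mark `b` in a mark-free-otherwise pocket hanging at the root `a₁`**: every statement vertex
outside the pocket is closed. -/
theorem closedAt_of_b_pocket_root₁ (h : IsPocket ends W a₁ P) (he : e₀ ∈ P) (hb : b ∈ W)
    (ho : o ∉ W) (h2 : a₂ ∉ W) (ha : a₃ ∉ W) : ClosedAt R o a₁ a₂ b E ends a₃ :=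
  closedAt_of_pocket' (z := b) h he (Or.inl ho) (Or.inl h.x_not_mem) (Or.inl h2) (Or.inl ha)
    (Or.inr rfl)
    (closedAt_of_b_leaf_root₁ (h.isLeafAt_pocketEnds e₀ hb) (fun h' => ho (h' ▸ hb))
      (fun h' => h2 (h' ▸ hb)) (fun h' => ha (h' ▸ hb)))

/-- **The mark `b` in a mark-free-otherwise pocket hanging at the root `a₂`**: every statement vertex
outside the pocket is closed. -/
theorem closedAt_of_b_pocket_root₂ (h : IsPocket ends W a₂ P) (he : e₀ ∈ P) (hb : b ∈ W)
    (ho : o ∉ W) (h1 : a₁ ∉ W) (ha : a₃ ∉ W) : ClosedAt R o a₁ a₂ b E ends a₃ :=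
  closedAt_of_pocket' (z := b) h he (Or.inl ho) (Or.inl h1) (Or.inl h.x_not_mem) (Or.inl ha)
    (Or.inr rfl)
    (closedAt_of_b_leaf_root₂ (h.isLeafAt_pocketEnds e₀ hb) (fun h' => ho (h' ▸ hb))
      (fun h' => h1 (h' ▸ hb)) (fun h' => ha (h' ▸ hb)))

/-- **The mark `o` in a mark-free-otherwise pocket hanging at the root `a₂`**: every statement vertex
outside the pocket is closed. -/
theorem closedAt_of_o_pocket_root₂ (h : IsPocket ends W a₂ P) (he : e₀ ∈ P) (ho : o ∈ W)
    (h1 : a₁ ∉ W) (ha : a₃ ∉ W) (hb : b ∉ W) : ClosedAt R o a₁ a₂ b E ends a₃ :=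
  closedAt_of_pocket' (z := o) h he (Or.inr rfl) (Or.inl h1) (Or.inl h.x_not_mem) (Or.inl ha)
    (Or.inl hb)
    (closedAt_of_o_leaf_root₂ (h.isLeafAt_pocketEnds e₀ ho) (fun h' => h1 (h' ▸ ho))
      (fun h' => ha (h' ▸ ho)) (fun h' => hb (h' ▸ ho)))

end BPocket

end CaseOne

end Summit.Ventures.PercRepro2
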